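import Literature.NumberTheory.EllipticCurves.ZpExtensionGaloisTwistLocal
import Literature.NumberTheory.GaloisRepresentations.LocalKroneckerWeberInertiaProofs
import Literature.GroupTheory.PadicQuotientSectionProofs
import Literature.NumberTheory.EllipticCurves.SelmerCorankControlRatProofs
import Literature.NumberTheory.GaloisRepresentations.PadicIntCdOne
import HarnessLib

/-!
# T-42-mult in the kernel, XXXIV: the place above `p` of the cyclotomic `ℤ_p`-tower of `ℚ` — a LOCAL INERTIAL
# topological generator (`κ(res γ̃) = κ(γ)`), surjectivity of `κ ∘ res : Γ_{ℚ_v} ↠ ℤ_p`, `cd_p(Γ_{ℚ_v}/G_K) ≤ 1`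

Cell `bsd-2adic` (run/shared/lean/pub/bsd-2adic/), seat `bsd-2adic-t42` (BRIEF-T42), GEN 17. HONEST FRAMING:
research route; THEOREMS ONLY (no `def`, no named fact, no instance); nothing booked; BSD is not proved by any of
this. PARTITION: X5@2 multiplicative GV-transport rows (K4ᵐ B1·O1; the LOCAL statement `T2` at `2`, last open input of
`hF3b` after XXX) × p = 2 — types-the-object-of; bears_on K4 items 19922 / 19923
(`--supports stmt-BirchSwinnertonDyer-19923`). Brick (a) of HOME/t42/DESIGN-T42-ADDENDUM-18.md §A18.3.

* `exists_mem_absInertia_kappa_resGal_eq` — for the CYCLOTOMIC `κ` and a place `v ∋ p` of `ℚ`, every value `κ γ` is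
  attained on the local INERTIA group: `∃ σ ∈ I(ℚ̄_v/ℚ_v)`, `κ(res σ) = κ γ` (local Kronecker–Weber: `χ_p(I_{ℚ_p}) = ℤ_p^×`,
  tree `adicCompletion_rat_exists_mem_absInertia_cyclotomicCharacter_eq`; `ker κ = χ_p⁻¹(torsion)`);
* `surjective_kappa_comp_resGal` — `κ ∘ res : Γ_{ℚ_v} → ℤ_p` is onto (`2`, resp. `p`, is totally ramified in `ℚ_∞`);
* `groupCdLE_one_quotient_localSubgroup` — `cd_p(Γ_{ℚ_v} ⧸ G_K) ≤ 1` for `G_K = (ker κ)_v` (`≅ ℤ_p`; tree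
  `PadicIntCdOne.groupCdLE_one_quotient_ker_of_surjective`).

References: [SerreLocalFields1979] IV §4 Prop. 17; [Washington1997] §13.1; [SerreGaloisCohomology1997] I §3.4.
-/

set_option autoImplicit false
set_option linter.dupNamespace false

noncomputable section

open scoped Classical

namespace Summit.BirchSwinnertonDyer.BirchSwinnertonDyer.Theorems.MultTransportTwistedDescent

open NumberField IsDedekindDomain Field
  Literature.NumberTheory.GaloisRepresentations Literature.NumberTheory.EllipticCurves Literature.GroupTheory

variable (p : ℕ) [hp : Fact p.Prime] (κ : ZpExtension ℚ p) {v : HeightOneSpectrum (𝓞 ℚ)}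

/-- **Local inertial lifts of `κ`-values**: for the cyclotomic `ℤ_p`-extension `κ` of `ℚ`, a place `v ∋ p` and any
`γ ∈ Γ_ℚ` there is `σ` in the inertia group of `Γ_{ℚ_v}` with `κ(res σ) = κ γ`. (Pick `σ` with `χ_p(σ) = χ_p(γ)` by local
Kronecker–Weber; `χ_p(res σ) = χ_p(σ)`; `γ⁻¹ res σ ∈ ker χ_p ⊆ χ_p⁻¹(torsion) = ker κ`.)
[cite: SerreLocalFields1979, Ch. IV §4 Prop. 17] [cite: Washington1997, §13.1] -/
theorem exists_mem_absInertia_kappa_resGal_eq (hκ : κ.IsCyclotomic) (hpv : ((p : ℕ) : 𝓞 ℚ) ∈ v.asIdeal)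
    (γ : absoluteGaloisGroup ℚ) :
    ∃ σ ∈ absInertia (v.adicCompletion ℚ), κ (resGal (K := ℚ) (v.adicCompletion ℚ) σ) = κ γ := by
  have hvp : (Rat.HeightOneSpectrum.primesEquiv v : ℕ) = p :=
    Rat.HeightOneSpectrum.primesEquiv_eq_of_natCast_mem v hp.out hpv
  obtain ⟨σ, hσ, hχ⟩ := adicCompletion_rat_exists_mem_absInertia_cyclotomicCharacter_eq p v hvp
    (GaloisRep.cyclotomicCharacter ℚ p γ)
  refine ⟨σ, hσ, ?_⟩
  have hres : GaloisRep.cyclotomicCharacter ℚ p (resGal (K := ℚ) (v.adicCompletion ℚ) σ) =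
      GaloisRep.cyclotomicCharacter ℚ p γ := by
    rw [WeierstrassCurve.resGal_eq_absGaloisRestrict, cyclotomicCharacter_absGaloisRestrict ℚ (v.adicCompletion ℚ) p σ,
      hχ]
  have hmem : γ⁻¹ * resGal (K := ℚ) (v.adicCompletion ℚ) σ ∈ κ.kerSubgroup := by
    rw [hκ, Subgroup.mem_comap]
    change GaloisRep.cyclotomicCharacter ℚ p (γ⁻¹ * resGal (K := ℚ) (v.adicCompletion ℚ) σ) ∈ _
    rw [map_mul, map_inv, hres, inv_mul_cancel]
    exact Subgroup.one_mem _
  rw [ZpExtension.mem_kerSubgroup, map_mul, map_inv, inv_mul_eq_one] at hmem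
  exact hmem.symm

/-- **`κ ∘ res : Γ_{ℚ_v} → ℤ_p` is surjective** (`v ∋ p`, `κ` cyclotomic): its image is a compact subgroup containing
a topological generator (`exists_mem_absInertia_kappa_resGal_eq` with `κ γ = 1`, `κ` itself being onto), hence
everything (`exists_mem_closure_zpowers_kappa_eq`). [cite: Washington1997, §13.1] -/
theorem surjective_kappa_comp_resGal (hκ : κ.IsCyclotomic) (hpv : ((p : ℕ) : 𝓞 ℚ) ∈ v.asIdeal) :
    Function.Surjective
      (κ.toContinuousMonoidHom.comp (resGal (K := ℚ) (v.adicCompletion ℚ))) := by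
  haveI := absoluteGaloisGroup_compactSpace (v.adicCompletion ℚ)
  obtain ⟨γ, hγ⟩ := κ.surjective (Multiplicative.ofAdd 1)
  obtain ⟨σ, -, hσ⟩ := exists_mem_absInertia_kappa_resGal_eq p κ hκ hpv γ
  intro z
  obtain ⟨x, -, hx⟩ := exists_mem_closure_zpowers_kappa_eq
    (κ := κ.toContinuousMonoidHom.comp (resGal (K := ℚ) (v.adicCompletion ℚ))) (γp := σ)
    (by change κ (resGal (K := ℚ) (v.adicCompletion ℚ) σ) = _; rw [hσ]; exact hγ) z
  exact ⟨x, hx⟩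

/-- The local group `G_K = (ker κ)_v` is the kernel of `κ ∘ res` (definitional). [folklore] -/
theorem localSubgroup_kerSubgroup_eq_ker :
    localSubgroup κ.kerSubgroup (v.adicCompletion ℚ) =
      (κ.toContinuousMonoidHom.comp (resGal (K := ℚ) (v.adicCompletion ℚ))).toMonoidHom.ker := rfl

/-- **`cd_p(Γ_{ℚ_v} ⧸ G_K) ≤ 1`** for `G_K = (ker κ)_v`, `v ∋ p`, `κ` cyclotomic (`Γ_{ℚ_v}/G_K ≅ ℤ_p`).
[cite: SerreGaloisCohomology1997, I §3.4] -/
theorem groupCdLE_one_quotient_localSubgroup (hκ : κ.IsCyclotomic) (hpv : ((p : ℕ) : 𝓞 ℚ) ∈ v.asIdeal) :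
    GroupCdLE (absoluteGaloisGroup (v.adicCompletion ℚ) ⧸
      (κ.toContinuousMonoidHom.comp (resGal (K := ℚ) (v.adicCompletion ℚ))).toMonoidHom.ker) p 1 := by
  haveI := absoluteGaloisGroup_compactSpace (v.adicCompletion ℚ)
  exact groupCdLE_one_quotient_ker_of_surjective _ (surjective_kappa_comp_resGal p κ hκ hpv)

end Summit.BirchSwinnertonDyer.BirchSwinnertonDyer.Theorems.MultTransportTwistedDescent

end
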